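import Summits.Langlands.Langlands.Theorems.IrreducibilityBySelfDualityPairLBoundaryJS
import Literature.NumberTheory.Automorphic.JPSSProjectedGlobalIntegral
import Literature.NumberTheory.Automorphic.JPSSGlobalIntegral

/-!
# The projected `GL_n × GL_m` Rankin–Selberg integral, `m < n` — part 1: the fibre integral
# `𝓚^ℙ_s(g)` granted the compact-set decay (H1) of the projected cusp form

Summit `Langlands`, sub-problem `Langlands`, helper file under `Theorems/` supporting the crux
`PairLBoundaryJS` (stmt-Langlands-13622), line `Sketch`, wave 3 (the projector road), registered sub-stub
`stub_gap_proj_analytic_part1` of `stub_gap_proj_analytic` (`GapProjectedAnalytic`). The section `Integrand` of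
`Literature.NumberTheory.Automorphic.JPSSGlobalIntegral` (Cogdell (2004), §2.2, PDF p. 182) rewritten for the
PROJECTED fibre integral of `JPSSProjectedGlobalIntegral`,

  `jpssProjKernel hmn φ s g = ∫_ℝ Φ_m(ι(z(e^u) g)) |det (z(e^u) g)|_𝔸^{s - (n-m)/2} du`,

`Φ_m = whittakerDepth m (invQuot φ)` the partial Whittaker transform of depth `m` (Cogdell's projector `ℙⁿ_m`,
§2.2.1: `ℙφ(h; 1) = |det h|^{-(n-m-1)/2} Φ_m(diag(h, 1_{n-m}))`), `ι = glCorner = diag(·, 1_{n-m})`,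
`z(e^u) = scalarExp m K u`. The decay input — for the bare corner the theorem `exists_bound_corner_scalarExp`
of `CuspFormCornerDecay` — is the HYPOTHESIS

* (H1) `hdec₁`: for every compact `Ω ⊆ GL_m(𝔸_K)` and `B > 0` there is `C ≥ 0` with
  `‖Φ_m(ι(z(e^u) g))‖ ≤ C e^{-B|u|}` for `g ∈ Ω`, `u ∈ ℝ`

(in exactly that shape, to be supplied by quantitative reduction theory for `Φ_m`). Results: the integrand is
dominated by `C e^{-|u|}` on compact sets of `g` and unit bands of `re s` (`exists_bound_jpssProjIntegrand`),
so the fibre integral converges absolutely (`integrable_jpssProjIntegrand`), is continuous in `g`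
(`continuous_jpssProjKernel`, dominated convergence) and entire in `s` (`differentiable_jpssProjKernel`,
dominated holomorphic parameter integral), for `Φ = invQuot φ` continuous (`Φ_m` is then continuous,
`continuous_whittakerDepth`).

## References

* J. W. Cogdell, *Analytic theory of L-functions for GL_n*, in J. Bernstein, S. Gelbart (eds.),
  *An Introduction to the Langlands Program*, Birkhäuser (2004), §2.2 (PDF pp. 181–184), Thm. 2.1
  [CogdellAnalyticTheory2004].
* H. Jacquet, I. I. Piatetski-Shapiro, J. Shalika, *Rankin–Selberg convolutions*, Amer. J. Math.
  105 (1983), 367–464 [JacquetPiatetskiShapiroShalika1983].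
-/

noncomputable section

-- `Summit.Langlands.Langlands.…` (summit = sub-problem name, D-0017 layout) trips `dupNamespace`
set_option linter.dupNamespace false

open scoped MatrixGroups Topology Pointwise ENNReal NNReal ComplexConjugate InnerProductSpace ContDiff
-- the place subtypes indexing `mixedSpace K` are `Fintype` classically (`NormedCommRing (mixedSpace K)`)
open scoped Classical Matrix.Norms.Operator
open NumberField IsDedekindDomain MeasureTheory Measure Matrix Set Filter WithZero
open NumberField.mixedEmbedding
open Literature.NumberTheory.Automorphic AdelicGroupData
open Literature.NumberTheory.GaloisRepresentations (ideleGroup HeckeCharacter)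
open Literature.MeasureTheory.Group
open Literature.RingTheory.SymmetricFunctions.SymmPoly
open ValuativeRel

-- the automorphic quotient carries the tree's Borel σ-algebra, not Mathlib's quotient σ-algebra
attribute [-instance] Quotient.instMeasurableSpace QuotientGroup.measurableSpace

-- the house local instances, exactly as in `RankinSelbergUnfoldingIdentity`
attribute [local instance] adelicBorel borelSpace_adelic locallyCompactSpace_adelic secondCountableTopology_gl_adelic
  glAdeleBorel borelSpace_glAdele borelSpace_ideleGroup secondCountableTopology_ideleGroup

-- Mathlib idiom: the commutator Lie ring on matrices, to mention `(archGroupGL n K).lie`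
attribute [local instance 100] LieRing.ofAssociativeRing

namespace Summit.Langlands.Langlands.Theorems.GapProjectedAnalyticPart1

/-! ### The integrand of the projected fibre integral: norm, continuity, domination -/

section Integrand

variable {n m : ℕ} {K : Type} [Field K] [NumberField K]

local notation "𝔸" => AdeleRing (𝓞 K) K

/-- **Domination of the projected integrand on compact sets and unit bands, from (H1).** For a compact
`Ω ⊆ GL_m(𝔸_K)` and `σ₀ ∈ ℝ` there is `C ≥ 0` with
`‖Φ_m(ι(z(e^u) g)) |det (z(e^u) g)|^{s-(n-m)/2}‖ ≤ C e^{-|u|}` for all `g ∈ Ω`, all `s` with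
`|re s - σ₀| ≤ 1` and all `u` ((H1) with `B = m[K:ℚ](|σ₀ - (n-m)/2| + 1) + 1`, and `|det g|^{±1}` bounded
on `Ω`). [cite: CogdellAnalyticTheory2004, §2.2 (PDF p. 182)] -/
theorem exists_bound_jpssProjIntegrand (hmn : m < n) {φ : (gl n K).automorphicQuotient → ℂ}
    (hdec₁ : ∀ Ω : Set (GL (Fin m) 𝔸), IsCompact Ω → ∀ B : ℝ, 0 < B → ∃ C : ℝ, 0 ≤ C ∧
      ∀ g ∈ Ω, ∀ u : ℝ, ‖whittakerDepth m (invQuot (gl n K) φ) (glCorner 𝔸 hmn.le (scalarExp m K u * g))‖ ≤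
        C * Real.exp (-B * |u|))
    {Ω : Set (GL (Fin m) 𝔸)} (hΩ : IsCompact Ω) (σ₀ : ℝ) :
    ∃ C : ℝ, 0 ≤ C ∧ ∀ g ∈ Ω, ∀ s : ℂ, |s.re - σ₀| ≤ 1 → ∀ u : ℝ,
      ‖whittakerDepth m (invQuot (gl n K) φ) (glCorner 𝔸 hmn.le (scalarExp m K u * g)) *
          ((((glAbsDet m K (scalarExp m K u * g) : ℝ≥0ˣ) : ℝ≥0) : ℝ) : ℂ) ^ (s - ((n : ℂ) - (m : ℂ)) / 2)‖ ≤
        C * Real.exp (-|u|) := by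
  set Φ : GL (Fin n) 𝔸 → ℂ := whittakerDepth m (invQuot (gl n K) φ) with hΦ
  set c₀ : ℝ := ((n : ℝ) - (m : ℝ)) / 2 with hc₀
  set D : ℕ := m * Module.finrank ℚ K with hD
  set E₀ : ℝ := |σ₀ - c₀| + 1 with hE₀
  have hE₀0 : 0 < E₀ := by positivity
  set B : ℝ := (D : ℝ) * E₀ + 1 with hB
  have hB0 : 0 < B := by positivity
  obtain ⟨C₁, hC₁0, hC₁⟩ := hdec₁ Ω hΩ B hB0
  -- `|det g|^{±1}` is bounded on `Ω`
  have hNc : Continuous fun g : GL (Fin m) 𝔸 => (((glAbsDet m K g : ℝ≥0ˣ) : ℝ≥0) : ℝ) :=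
    continuous_glAbsDet_real m K
  obtain ⟨W₁, hW₁⟩ := (hΩ.image hNc).isBounded.bddAbove
  obtain ⟨W₂, hW₂⟩ := (hΩ.inv.image hNc).isBounded.bddAbove
  set W : ℝ := max (max W₁ W₂) 1 with hW
  have hW1 : 1 ≤ W := le_max_right _ _
  have hNle : ∀ g ∈ Ω, (((glAbsDet m K g : ℝ≥0ˣ) : ℝ≥0) : ℝ) ≤ W := fun g hg =>
    (hW₁ ⟨g, hg, rfl⟩).trans ((le_max_left _ _).trans (le_max_left _ _))
  have hNle' : ∀ g ∈ Ω, (((glAbsDet m K g : ℝ≥0ˣ) : ℝ≥0) : ℝ)⁻¹ ≤ W := by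
    intro g hg
    have h : (((glAbsDet m K g⁻¹ : ℝ≥0ˣ) : ℝ≥0) : ℝ) ≤ W₂ := hW₂ ⟨g⁻¹, Set.inv_mem_inv.2 hg, rfl⟩
    rw [map_inv, Units.val_inv_eq_inv_val, NNReal.coe_inv] at h
    exact h.trans ((le_max_right _ _).trans (le_max_left _ _))
  refine ⟨C₁ * W ^ E₀, by positivity, fun g hg s hs u => ?_⟩
  rw [norm_jpssProjIntegrand hmn, ← hc₀, glAbsDet_scalarExp_mul,
    Real.mul_rpow (Real.exp_pos _).le (glAbsDet_real_pos g).le]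
  have he : |s.re - c₀| ≤ E₀ := by
    calc |s.re - c₀| = |(s.re - σ₀) + (σ₀ - c₀)| := by ring_nf
      _ ≤ |s.re - σ₀| + |σ₀ - c₀| := abs_add_le _ _
      _ ≤ 1 + |σ₀ - c₀| := by linarith
      _ = E₀ := by rw [hE₀]; ring
  -- the three factors
  have h1 : ‖Φ (glCorner 𝔸 hmn.le (scalarExp m K u * g))‖ ≤ C₁ * Real.exp (-B * |u|) := hC₁ g hg u
  have h2 : Real.exp (u * (D : ℕ)) ^ (s.re - c₀) ≤ Real.exp ((D : ℝ) * E₀ * |u|) := by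
    rw [← Real.exp_mul]
    refine Real.exp_le_exp.2 ?_
    calc u * (D : ℕ) * (s.re - c₀) ≤ |u * (D : ℕ) * (s.re - c₀)| := le_abs_self _
      _ = (D : ℝ) * (|u| * |s.re - c₀|) := by
          rw [abs_mul, abs_mul, Nat.abs_cast]; ring
      _ ≤ (D : ℝ) * (|u| * E₀) := by gcongr
      _ = (D : ℝ) * E₀ * |u| := by ring
  have h3 : (((glAbsDet m K g : ℝ≥0ˣ) : ℝ≥0) : ℝ) ^ (s.re - c₀) ≤ W ^ E₀ :=
    rpow_le_rpow_of_le_of_inv_le (glAbsDet_real_pos g) hW1 (hNle g hg) (hNle' g hg) he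
  have h0 : 0 ≤ Real.exp (u * (D : ℕ)) ^ (s.re - c₀) := Real.rpow_nonneg (Real.exp_pos _).le _
  calc ‖Φ (glCorner 𝔸 hmn.le (scalarExp m K u * g))‖ *
        (Real.exp (u * (D : ℕ)) ^ (s.re - c₀) *
          (((glAbsDet m K g : ℝ≥0ˣ) : ℝ≥0) : ℝ) ^ (s.re - c₀))
      ≤ (C₁ * Real.exp (-B * |u|)) * (Real.exp ((D : ℝ) * E₀ * |u|) * W ^ E₀) := by
        refine mul_le_mul h1 (mul_le_mul h2 h3 (Real.rpow_nonneg (glAbsDet_real_pos g).le _)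
          (Real.exp_pos _).le) (by positivity) (by positivity)
    _ = C₁ * W ^ E₀ * (Real.exp (-B * |u|) * Real.exp ((D : ℝ) * E₀ * |u|)) := by ring
    _ = C₁ * W ^ E₀ * Real.exp (-|u|) := by
        rw [← Real.exp_add, hB]; ring_nf

/-- **Absolute convergence of the projected fibre integral** for every `s` and `g`, from (H1) and
continuity of `Φ`. [cite: CogdellAnalyticTheory2004, §2.2 (PDF p. 182)] -/
theorem integrable_jpssProjIntegrand (hmn : m < n) {φ : (gl n K).automorphicQuotient → ℂ}
    (hφc : Continuous (invQuot (gl n K) φ))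
    (hdec₁ : ∀ Ω : Set (GL (Fin m) 𝔸), IsCompact Ω → ∀ B : ℝ, 0 < B → ∃ C : ℝ, 0 ≤ C ∧
      ∀ g ∈ Ω, ∀ u : ℝ, ‖whittakerDepth m (invQuot (gl n K) φ) (glCorner 𝔸 hmn.le (scalarExp m K u * g))‖ ≤
        C * Real.exp (-B * |u|))
    (s : ℂ) (g : GL (Fin m) 𝔸) :
    Integrable fun u : ℝ =>
      whittakerDepth m (invQuot (gl n K) φ) (glCorner 𝔸 hmn.le (scalarExp m K u * g)) *
        ((((glAbsDet m K (scalarExp m K u * g) : ℝ≥0ˣ) : ℝ≥0) : ℝ) : ℂ) ^ (s - ((n : ℂ) - (m : ℂ)) / 2) := by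
  obtain ⟨C, -, hC⟩ := exists_bound_jpssProjIntegrand hmn hdec₁ isCompact_singleton s.re
  have hcont := (continuous_jpssProjIntegrand hmn hφc s).comp (Continuous.prodMk_right g)
  refine Integrable.mono' ((integrable_exp_neg_mul_abs_real one_pos).const_mul C)
    hcont.aestronglyMeasurable (Eventually.of_forall fun u => ?_)
  have h := hC g rfl s (by simp) u
  simpa [neg_mul, one_mul] using h

/-- **The projected fibre integral is continuous in `g`** (dominated convergence on a compact
neighbourhood, `GL_m(𝔸_K)` being locally compact). [cite: CogdellAnalyticTheory2004, §2.2 (PDF p. 182)] -/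
theorem continuous_jpssProjKernel (hmn : m < n) {φ : (gl n K).automorphicQuotient → ℂ}
    (hφc : Continuous (invQuot (gl n K) φ))
    (hdec₁ : ∀ Ω : Set (GL (Fin m) 𝔸), IsCompact Ω → ∀ B : ℝ, 0 < B → ∃ C : ℝ, 0 ≤ C ∧
      ∀ g ∈ Ω, ∀ u : ℝ, ‖whittakerDepth m (invQuot (gl n K) φ) (glCorner 𝔸 hmn.le (scalarExp m K u * g))‖ ≤
        C * Real.exp (-B * |u|))
    (s : ℂ) : Continuous (jpssProjKernel hmn φ s) := by
  haveI : LocallyCompactSpace (GL (Fin m) 𝔸) :=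
    AdelicGroupData.locallyCompactSpace_generalLinearGroup_adeleRing K (Fin m)
  haveI : SecondCountableTopology (GL (Fin m) 𝔸) :=
    secondCountableTopology_generalLinearGroup_adeleRing K (Fin m)
  refine continuous_iff_continuousAt.2 fun g₀ => ?_
  obtain ⟨Ω, hΩc, hΩ⟩ := exists_compact_mem_nhds g₀
  obtain ⟨C, -, hC⟩ := exists_bound_jpssProjIntegrand hmn hdec₁ hΩc s.re
  have hcont := continuous_jpssProjIntegrand hmn hφc s
  refine continuousAt_of_dominated (bound := fun u => C * Real.exp (-(1 : ℝ) * |u|)) ?_ ?_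
    ((integrable_exp_neg_mul_abs_real one_pos).const_mul C) ?_
  · exact Eventually.of_forall fun g => (hcont.comp (Continuous.prodMk_right g)).aestronglyMeasurable
  · filter_upwards [hΩ] with g hg
    refine Eventually.of_forall fun u => ?_
    simpa [neg_mul, one_mul] using hC g hg s (by simp) u
  · exact Eventually.of_forall fun u => (hcont.comp (Continuous.prodMk_left u)).continuousAt

/-- **The projected fibre integral is an entire function of `s`** for every `g` (dominated holomorphic
parameter integral on unit balls). [cite: CogdellAnalyticTheory2004, §2.2 (PDF p. 182), Thm. 2.1] -/
theorem differentiable_jpssProjKernel (hmn : m < n) {φ : (gl n K).automorphicQuotient → ℂ}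
    (hφc : Continuous (invQuot (gl n K) φ))
    (hdec₁ : ∀ Ω : Set (GL (Fin m) 𝔸), IsCompact Ω → ∀ B : ℝ, 0 < B → ∃ C : ℝ, 0 ≤ C ∧
      ∀ g ∈ Ω, ∀ u : ℝ, ‖whittakerDepth m (invQuot (gl n K) φ) (glCorner 𝔸 hmn.le (scalarExp m K u * g))‖ ≤
        C * Real.exp (-B * |u|))
    (g : GL (Fin m) 𝔸) :
    Differentiable ℂ fun s => jpssProjKernel hmn φ s g := by
  suffices h : DifferentiableOn ℂ (fun s => jpssProjKernel hmn φ s g) univ from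
    fun s => h.differentiableAt (isOpen_univ.mem_nhds (mem_univ s))
  unfold jpssProjKernel
  refine Literature.Analysis.Complex.differentiableOn_integral_of_dominated (μ := volume) ?_ ?_ ?_
  · intro s _
    exact ((continuous_jpssProjIntegrand hmn hφc s).comp (Continuous.prodMk_right g)).aestronglyMeasurable
  · refine Eventually.of_forall fun u s _ => ?_
    have hN : ((((glAbsDet m K (scalarExp m K u * g) : ℝ≥0ˣ) : ℝ≥0) : ℝ) : ℂ) ≠ 0 :=
      Complex.ofReal_ne_zero.2 (glAbsDet_real_pos _).ne'
    exact (((differentiableAt_id.sub_const _).const_cpow (Or.inl hN)).const_mul _).differentiableWithinAt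
  · intro s₀ _
    obtain ⟨C, -, hC⟩ := exists_bound_jpssProjIntegrand hmn hdec₁ isCompact_singleton s₀.re
    refine ⟨1, one_pos, subset_univ _, fun u => C * Real.exp (-(1 : ℝ) * |u|),
      (integrable_exp_neg_mul_abs_real one_pos).const_mul C, Eventually.of_forall fun u s hs => ?_⟩
    have hre : |s.re - s₀.re| ≤ 1 := by
      rw [Metric.mem_ball, dist_eq_norm] at hs
      have h1 : |s.re - s₀.re| ≤ ‖s - s₀‖ := by
        simpa [Complex.sub_re] using Complex.abs_re_le_norm (s - s₀)
      exact h1.trans hs.le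
    simpa [neg_mul, one_mul] using hC g rfl s hre u

end Integrand

/-! ### The registered sub-stub -/

/-- **SUB-STUB (wave 3, W2, part 1) — the projected fibre integral granted (H1).** For `m < n`, `φ` on
`GL_n(𝔸_K) ⧸ A_G GL_n(K)` with `Φ = invQuot φ` continuous and the compact-set decay (H1) of
`Φ_m = whittakerDepth m Φ` along the split centre of the corner: `g ↦ jpssProjKernel hmn φ s g` is continuous
for every `s`, and `s ↦ jpssProjKernel hmn φ s g` is entire for every `g` (Cogdell (2004), §2.2, PDF p. 182).
[cite: CogdellAnalyticTheory2004, §2.2 (PDF p. 182)] -/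
theorem stub_gap_proj_analytic_part1 :
    ∀ {n m : ℕ} {K : Type} [Field K] [NumberField K] (hmn : m < n)
      {φ : (AdelicGroupData.gl n K).automorphicQuotient → ℂ},
      Continuous (invQuot (AdelicGroupData.gl n K) φ) →
      (∀ Ω : Set (GL (Fin m) (AdeleRing (𝓞 K) K)), IsCompact Ω → ∀ B : ℝ, 0 < B → ∃ C : ℝ, 0 ≤ C ∧
        ∀ g ∈ Ω, ∀ u : ℝ, ‖whittakerDepth m (invQuot (AdelicGroupData.gl n K) φ)
          (glCorner (AdeleRing (𝓞 K) K) hmn.le (scalarExp m K u * g))‖ ≤ C * Real.exp (-B * |u|)) →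
      (∀ s : ℂ, Continuous (jpssProjKernel hmn φ s)) ∧
        ∀ g : GL (Fin m) (AdeleRing (𝓞 K) K), Differentiable ℂ fun s => jpssProjKernel hmn φ s g := by
  intro n m K _ _ hmn φ hφc hdec₁
  exact ⟨fun s => continuous_jpssProjKernel hmn hφc hdec₁ s, fun g => differentiable_jpssProjKernel hmn hφc hdec₁ g⟩

end Summit.Langlands.Langlands.Theorems.GapProjectedAnalyticPart1
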